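import Summits.CriticalPhenomena.PercolationContinuityZ3.Theorems.PercNearOneGluingNoHeavyLowerTailSahiCombCylinder
import Summits.CriticalPhenomena.PercolationContinuityZ3.Theorems.PercNearOneGluingNoHeavyLowerTailSahiCombSubstitution
import Summits.CriticalPhenomena.PercolationContinuityZ3.Theorems.SahiMasterFamilyPrincipalDomination

/-!
# The comb hierarchy for Sahi's `E_k`: cylinder families are comb-positive at the MINIMAL multidegree (M⁺⁺ for AND-events)

Support file of the one-cut programme (crux `NoHeavyLowerTail`, stmt-CriticalPhenomena-4575; cell `prim-masterthm`, seat P5 gen 4; report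
`P5-LORENTZIAN-TEST.md` §9.1/§9.4).  `…SahiCombCylinder` (seat P3) proved that `p ↦ E_n(μ_p; 1_{[S_0]},…,1_{[S_{n−1}]})` for CYLINDER events
`[S] = {ω | S ⊆ ω}` is a nonnegative combination of the tensor-Bernstein basis of the uniform multidegree `n` (comb form of Sahi's Theorem 2 on
product measures).  As a polynomial in `p_e` that function has degree only `d_e = #{j : e ∈ S_j}`; the census of report §9.1 ((M⁺⁺-k): 0 violations,
k ≤ 6) says the Bernstein coefficients are nonnegative ALREADY at the minimal multidegree `d = (d_e)_e`, and report §9.3–9.4 proves it for cylinder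
families on paper (Theorem (U) on union-closed block systems, Lean `…SahiUnionClosed`, + an exact regrouping identity).  This file proves the same
statement in Lean by the OTHER route: P3's freeze/conditioning induction (`sahiE_marked_eq`, `combPos_negSahiE_freezeDiff`) re-run with exact
multidegree bookkeeping — every factor is carried at its own support (`combPos_ex_ind_supported`), and the degrees add up to at most `d`:

* `combPos_negSahiE_freezeDiff_cyl` — `[n = 0] − E^{μ_p − μ_{p[Q↦1]}}_n([S_0],…,[S_{n−1}])` is comb-positive at multidegree `Σ_j 1_{S_j}`;
* **`combPos_sahiE_ind_cylinders_minDegree`** — for every `n` and every `S : Fin n → Set ι`,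
  `CombPos (fun e => Σ_j [e ∈ S_j]) (p ↦ E_n(μ_p; 1_{[S_0]},…,1_{[S_{n−1}]}))`: (M⁺⁺-n) for AND-events, every `n`.
By degree elevation (`CombPos.mono`, `d_e ≤ n`) this contains `combPos_sahiE_ind_of_cylinders` (not restated).  HONEST LABEL: cylinder (principal) events only; nothing here
asserts (M⁺⁺-k) or (M⁺-k) for general increasing events (census-clean, OPEN). [this work]
-/

noncomputable section

open scoped Classical

namespace Summit.CriticalPhenomena.PercolationContinuityZ3.Theorems

open Finset Function
open Literature.Combinatorics.Sahi2008
open Literature.Probability.Percolation (DeterminedBy determinedBy_iff)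
open Literature.Probability.Percolation.DecisionTree (ind ind_of_mem ind_of_not_mem ind_nonneg)
open SahiComb SahiCylinderIdentity SahiMomentExpansion

namespace SahiCylMinDeg

variable {ι : Type} [Fintype ι]

/-! ### Degree bookkeeping -/

omit [Fintype ι] in
/-- Transport comb positivity along an equality of multidegrees. [folklore] -/
theorem combPos_of_deg_eq [Fintype ι] {c d : ι → ℕ} {F : (ι → unitInterval) → ℝ} (h : CombPos c F) (hcd : c = d) : CombPos d F :=
  hcd ▸ h

omit [Fintype ι] in
/-- Re-indexing a sum along `orderEmbOfFin`. [folklore] -/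
theorem sum_orderEmbOfFin' {k : ℕ} {β : Type*} [AddCommMonoid β] (T : Finset (Fin k)) (φ : Fin k → β) :
    ∑ l : Fin T.card, φ (T.orderEmbOfFin rfl l) = ∑ i ∈ T, φ i := by
  rw [← Finset.sum_coe_sort T]
  exact Fintype.sum_equiv (T.orderIsoOfFin rfl).toEquiv _ _ fun l => rfl

omit [Fintype ι] in
/-- Degree of the merged family: replacing `T_l` by `T_l ∪ R` raises the multidegree by at most `1_R`. [folklore] -/
theorem deg_update_union_le {m : ℕ} (T : Fin m → Set ι) (l : Fin m) (R : Set ι) (e : ι) :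
    (∑ j, if e ∈ update T l (T l ∪ R) j then 1 else 0 : ℕ) ≤ (if e ∈ R then 1 else 0) + ∑ j, if e ∈ T j then 1 else 0 := by
  have hl : ∀ j ∈ univ.erase l, (if e ∈ update T l (T l ∪ R) j then 1 else 0 : ℕ) = if e ∈ T j then 1 else 0 := fun j hj => by
    rw [update_of_ne (Finset.ne_of_mem_erase hj)]
  rw [← Finset.add_sum_erase univ _ (mem_univ l), ← Finset.add_sum_erase univ (fun j => if e ∈ T j then 1 else (0 : ℕ)) (mem_univ l),
    Finset.sum_congr rfl hl, update_self]
  by_cases hT : e ∈ T l <;> by_cases hR : e ∈ R <;> simp [hT, hR]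

/-! ### Cylinder events -/

omit [Fintype ι] in
/-- `[A] ∩ [B] = [A ∪ B]`. [folklore] -/
theorem cyl_inter (A B : Set ι) : ({ω : Set ι | A ⊆ ω} ∩ {ω : Set ι | B ⊆ ω}) = {ω : Set ι | A ∪ B ⊆ ω} := by
  ext ω; simp [Set.union_subset_iff]

omit [Fintype ι] in
/-- The set difference `[R ∖ Q] ∖ [R]` is determined by `R`. [folklore] -/
theorem determinedBy_cyl_sdiff (Q R : Set ι) : DeterminedBy ({ω : Set ι | R \ Q ⊆ ω} \ {ω : Set ι | R ⊆ ω}) R := by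
  rw [determinedBy_iff]
  intro ω ω' h
  have h1 := (determinedBy_iff _ _).1 (determinedBy_cylinder (R \ Q)) ω ω'
    (by rw [Set.inter_comm, Set.inter_comm ω'] at h ⊢
        ext x; constructor
        · rintro ⟨hx1, hx2⟩; exact ⟨hx1, ((Set.ext_iff.1 h x).1 ⟨hx1.1, hx2⟩).2⟩
        · rintro ⟨hx1, hx2⟩; exact ⟨hx1, ((Set.ext_iff.1 h x).2 ⟨hx1.1, hx2⟩).2⟩)
  have h2 := (determinedBy_iff _ _).1 (determinedBy_cylinder R) ω ω' h
  rw [Set.mem_sdiff, Set.mem_sdiff, h1, h2]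

/-- The probability of a cylinder is comb-positive at its own support. [this work] -/
theorem combPos_ex_ind_cyl (R : Set ι) :
    CombPos (fun e => if e ∈ R then 1 else 0) (fun p => ex (bernoulliWeight p) (ind {ω : Set ι | R ⊆ ω})) := by
  have h := SahiCombSubstitution.combPos_ex_ind_supported R.toFinset (X := {ω : Set ι | R ⊆ ω}) (by rw [Set.coe_toFinset]; exact determinedBy_cylinder R)
  refine (show (fun e => if e ∈ R.toFinset then 1 else (0 : ℕ)) = fun e => if e ∈ R then 1 else 0 from ?_) ▸ h
  funext e; simp only [Set.mem_toFinset]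

/-- `P_p([R]^{Q←1}) − P_p([R]) = P_p([R ∖ Q] ∖ [R])` is comb-positive at multidegree `1_R`. [this work] -/
theorem combPos_secUnion_sub_cyl (Q R : Set ι) :
    CombPos (fun e => if e ∈ R then 1 else 0)
      (fun p => ex (bernoulliWeight p) (ind (secUnion Q {ω : Set ι | R ⊆ ω})) - ex (bernoulliWeight p) (ind {ω : Set ι | R ⊆ ω})) := by
  have h := SahiCombSubstitution.combPos_ex_ind_supported R.toFinset (X := {ω : Set ι | R \ Q ⊆ ω} \ {ω : Set ι | R ⊆ ω})
    (by rw [Set.coe_toFinset]; exact determinedBy_cyl_sdiff Q R)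
  have hdeg : (fun e => if e ∈ R.toFinset then 1 else (0 : ℕ)) = fun e => if e ∈ R then 1 else 0 := by
    funext e; simp only [Set.mem_toFinset]
  rw [hdeg] at h
  refine h.congr fun p => ?_
  rw [secUnion_cylinder, ex_def, ex_def, ex_def, ← Finset.sum_sub_distrib]
  refine Finset.sum_congr rfl fun ω _ => ?_
  have hsub : {ω : Set ι | R ⊆ ω} ⊆ {ω : Set ι | R \ Q ⊆ ω} := fun ω hω => Set.Subset.trans Set.sdiff_subset hω
  by_cases h1 : ω ∈ {ω : Set ι | R ⊆ ω}
  · rw [ind_of_mem h1, ind_of_mem (hsub h1), ind_of_not_mem (fun h => h.2 h1)]; ring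
  · by_cases h2 : ω ∈ {ω : Set ι | R \ Q ⊆ ω}
    · rw [ind_of_not_mem h1, ind_of_mem h2, ind_of_mem (show ω ∈ _ \ _ from ⟨h2, h1⟩)]; ring
    · rw [ind_of_not_mem h1, ind_of_not_mem h2, ind_of_not_mem (fun h => h2 h.1)]; ring

omit [Fintype ι] in
/-- The event family of updated generators: `[update T l (T_l ∪ R) j] = update ([T j]) l ([T l]·[R])` as indicator families. [folklore] -/
theorem ind_cyl_update_union {m : ℕ} (T : Fin m → Set ι) (l : Fin m) (R : Set ι) :
    (fun j => ind {ω : Set ι | update T l (T l ∪ R) j ⊆ ω})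
      = update (fun j => ind {ω : Set ι | T j ⊆ ω}) l (ind {ω : Set ι | T l ⊆ ω} * ind {ω : Set ι | R ⊆ ω}) := by
  funext j
  by_cases hj : j = l
  · subst hj
    rw [update_self, update_self]
    funext ω
    rw [Pi.mul_apply]
    by_cases hA : ω ∈ {ω : Set ι | T j ⊆ ω}
    · by_cases hB : ω ∈ {ω : Set ι | R ⊆ ω}
      · rw [ind_of_mem hA, ind_of_mem hB, ind_of_mem (show ω ∈ {ω : Set ι | T j ∪ R ⊆ ω} from Set.union_subset hA hB)]; ring
      · rw [ind_of_mem hA, ind_of_not_mem hB, ind_of_not_mem (fun h : T j ∪ R ⊆ ω => hB (Set.subset_union_right.trans h))]; ring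
    · rw [ind_of_not_mem hA, ind_of_not_mem (fun h : T j ∪ R ⊆ ω => hA (Set.subset_union_left.trans h))]; ring
  · rw [update_of_ne hj, update_of_ne hj]

/-! ### The frozen difference on a cylinder family, minimal degree -/

/-- **`[n = 0] − E^ν_n([S_0],…,[S_{n−1}])` is comb-positive at multidegree `Σ_j 1_{S_j}`** for `ν = μ_p − μ_{p[Q↦1]}` (cylinder version of
`combPos_negSahiE_freezeDiff` with exact degrees). [this work] -/
theorem combPos_negSahiE_freezeDiff_cyl (Q : Set ι) :
    ∀ (n : ℕ) (S : Fin n → Set ι),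
      CombPos (fun e => ∑ j, if e ∈ S j then 1 else 0)
        (fun p => (if n = 0 then (1 : ℝ) else 0) - sahiE (freezeDiff Q p) n (fun j => ind {ω : Set ι | S j ⊆ ω}))
  | 0, S => (combPos_const _ zero_le_one).congr fun p => by rw [if_pos rfl, sahiE_zero, sub_zero]
  | 1, S => by
    have hdeg : (fun e => ∑ j : Fin 1, if e ∈ S j then 1 else (0 : ℕ)) = fun e => if e ∈ S 0 then 1 else 0 := by
      funext e; rw [Fin.sum_univ_one]
    rw [hdeg]
    refine (combPos_secUnion_sub_cyl Q (S 0)).congr fun p => ?_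
    rw [if_neg one_ne_zero, zero_sub, sahiE_one_apply, neg_ex_freezeDiff_ind]
  | n + 2, S => by
    set R : Set ι := S 0 with hR
    set T : Fin (n + 1) → Set ι := fun j => S j.succ with hT
    set D : ι → ℕ := fun e => ∑ j, if e ∈ S j then 1 else 0 with hD
    have hfam : (fun j => ind {ω : Set ι | S j ⊆ ω}) = Matrix.vecCons (ind {ω : Set ι | R ⊆ ω}) (fun j => ind {ω : Set ι | T j ⊆ ω}) := by
      funext j; refine Fin.cases rfl (fun i => rfl) j
    have hDsplit : ∀ e, D e = (if e ∈ R then 1 else 0) + ∑ j, if e ∈ T j then 1 else 0 := fun e => by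
      simp only [hD, hR, hT, Fin.sum_univ_succ]
    have htail : ∀ l : Fin (n + 1), CombPos D (fun p => (if n + 1 = 0 then (1 : ℝ) else 0) -
        sahiE (freezeDiff Q p) (n + 1) (fun j => ind {ω : Set ι | update T l (T l ∪ R) j ⊆ ω})) := fun l =>
      (combPos_negSahiE_freezeDiff_cyl Q (n + 1) (update T l (T l ∪ R))).mono fun e => by
        rw [hDsplit]; exact deg_update_union_le T l R e
    have hrest : CombPos (fun e => ∑ j, if e ∈ T j then 1 else 0) (fun p => (if n + 1 = 0 then (1 : ℝ) else 0) -
        sahiE (freezeDiff Q p) (n + 1) (fun j => ind {ω : Set ι | T j ⊆ ω})) :=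
      combPos_negSahiE_freezeDiff_cyl Q (n + 1) T
    have hδ : CombPos (fun e => if e ∈ R then 1 else 0) (fun p => - ex (freezeDiff Q p) (ind {ω : Set ι | R ⊆ ω})) :=
      (combPos_secUnion_sub_cyl Q R).congr fun p => neg_ex_freezeDiff_ind Q p _
    have hdeg : (fun e => ∑ j, if e ∈ T j then 1 else (0 : ℕ)) + (fun e => if e ∈ R then 1 else 0) = D := by
      funext e; rw [Pi.add_apply, hDsplit, add_comm]
    have htot := (CombPos.sum univ fun l _ => htail l).add (hrest.mul_of_eq hδ hdeg)
    refine htot.congr fun p => ?_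
    simp only [if_neg (Nat.succ_ne_zero _), zero_sub]
    rw [hfam, sahiE_cons]
    simp only [← ind_cyl_update_union, Finset.sum_neg_distrib]
    ring

/-- `polyB` of the frozen difference on a cylinder family: comb-positive at the support of the sub-family. [this work] -/
theorem combPos_polyB_freezeDiff_cyl (Q : Set ι) {k : ℕ} (T : Fin k → Set ι) (A : Finset (Fin k)) :
    CombPos (fun e => ∑ j ∈ A, if e ∈ T j then 1 else 0)
      (fun p => polyB (freezeDiff Q p) (fun j => ind {ω : Set ι | T j ⊆ ω}) A) := by
  have h := combPos_negSahiE_freezeDiff_cyl Q A.card (fun j => T (A.orderEmbOfFin rfl j))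
  have hdeg : (fun e => ∑ j : Fin A.card, if e ∈ T (A.orderEmbOfFin rfl j) then 1 else (0 : ℕ)) =
      fun e => ∑ j ∈ A, if e ∈ T j then 1 else 0 := by
    funext e; exact sum_orderEmbOfFin' A (fun j => if e ∈ T j then 1 else (0 : ℕ))
  refine (combPos_of_deg_eq h hdeg).congr fun p => ?_
  unfold polyB
  simp only [Finset.card_eq_zero]

/-- The marked term with `h = 1`, comb-positive at any multidegree carried by the sectioned sub-family. [this work] -/
theorem combPos_markedA_one_deg (Q : Set ι) {k : ℕ} (U : Fin k → Set (Set ι)) (A : Finset (Fin k)) {c : ι → ℕ}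
    (hA : CombPos c (fun p => sahiE (bernoulliWeight p) A.card (fun j => ind (secUnion Q (U (A.orderEmbOfFin rfl j)))))) :
    CombPos c (fun p => markedA (bernoulliWeight fun e => if e ∈ Q then 1 else p e) 1 (fun j => ind (U j)) A) := by
  by_cases h0 : A.card = 0
  · have hA0 : A = ∅ := Finset.card_eq_zero.1 h0
    subst hA0
    refine (combPos_const c zero_le_one).congr fun p => ?_
    unfold markedA
    exact ex_one (sum_bernoulliWeight _)
  · have hpos : 0 < A.card := Nat.pos_of_ne_zero h0
    refine (hA.smul (Nat.cast_nonneg (A.card - 1))).congr fun p => ?_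
    unfold markedA
    rw [sahiE_one_cons_of_pos (sum_bernoulliWeight _) hpos, sahiE_freeze_eq_secUnion]

/-! ### The cylinder head step and the theorem -/

/-- **Head step at minimal degree.**  If every sectioned sub-family `([T_j ∖ R])_{j ∈ A}` is comb-positive at its own support, then
`E_{k+1}(μ_p; 1_{[R]}, 1_{[T_0]},…,1_{[T_{k−1}]})` is comb-positive at multidegree `1_R + Σ_j 1_{T_j}`. [this work] -/
theorem combPos_cyl_head (R : Set ι) {k : ℕ} (T : Fin k → Set ι)
    (hsub : ∀ A : Finset (Fin k), CombPos (fun e => ∑ j ∈ A, if e ∈ T j \ R then 1 else 0)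
      (fun p => sahiE (bernoulliWeight p) A.card (fun j => ind (secUnion R {ω : Set ι | T (A.orderEmbOfFin rfl j) ⊆ ω})))) :
    CombPos (fun e => (if e ∈ R then 1 else 0) + ∑ j, if e ∈ T j then 1 else 0)
      (fun p => sahiE (bernoulliWeight p) (k + 1) (Matrix.vecCons (ind {ω : Set ι | R ⊆ ω}) (fun j => ind {ω : Set ι | T j ⊆ ω}))) := by
  set Dsum : ι → ℕ := fun e => ∑ j, if e ∈ T j then 1 else 0 with hDsum
  have hterm : ∀ A ∈ (univ : Finset (Finset (Fin k))), CombPos Dsum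
      (fun p => markedA (bernoulliWeight fun e => if e ∈ R then 1 else p e) 1 (fun j => ind {ω : Set ι | T j ⊆ ω}) A *
        polyB (freezeDiff R p) (fun j => ind {ω : Set ι | T j ⊆ ω}) Aᶜ) := fun A _ =>
    ((combPos_markedA_one_deg R (fun j => {ω : Set ι | T j ⊆ ω}) A (hsub A)).mul
      (combPos_polyB_freezeDiff_cyl R T Aᶜ)).mono fun e => by
        simp only [Pi.add_apply, hDsum]
        have h1 : (∑ j ∈ A, (if e ∈ T j \ R then 1 else 0 : ℕ)) ≤ ∑ j ∈ A, (if e ∈ T j then 1 else 0 : ℕ) :=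
          Finset.sum_le_sum fun j _ => by
            by_cases h1 : e ∈ T j \ R
            · rw [if_pos h1, if_pos h1.1]
            · rw [if_neg h1]; exact Nat.zero_le _
        have h2 := Finset.sum_add_sum_compl A (fun j => (if e ∈ T j then 1 else 0 : ℕ))
        omega
  have htot := (combPos_ex_ind_cyl R).mul_of_eq (CombPos.sum univ hterm) (m := fun e => (if e ∈ R then 1 else 0) + Dsum e) rfl
  refine htot.congr fun p => ?_
  have hid := sahiE_marked_eq (bernoulliWeight p) (bernoulliWeight fun e => if e ∈ R then 1 else p e) (freezeDiff R p)
    (ind {ω : Set ι | R ⊆ ω}) (∏ e, if e ∈ R then (p e : ℝ) else 1) (fun _ => rfl) (ex_ind_cylinder_mul p R) k 1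
    (fun j => ind {ω : Set ι | T j ⊆ ω})
  rw [mul_one] at hid
  rw [hid, ex_ind_cylinder_eq_prod]

/-- **(M⁺⁺) for AND-events: every family of cylinders is comb-positive at its MINIMAL multidegree.**  For every `n` and `S : Fin n → Set ι`,
`p ↦ E_n(μ_p; 1_{[S_0]},…,1_{[S_{n−1}]})` is a nonnegative combination of the tensor-Bernstein basis of multidegree `d_e = #{j : e ∈ S_j}`. [this work] -/
theorem combPos_sahiE_ind_cylinders_minDegree :
    ∀ (n : ℕ) (S : Fin n → Set ι),
      CombPos (fun e => ∑ j, if e ∈ S j then 1 else 0)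
        (fun p => sahiE (bernoulliWeight p) n (fun j => ind {ω : Set ι | S j ⊆ ω})) := by
  intro n
  induction n using Nat.strong_induction_on with
  | _ n ih =>
    intro S
    match n, S, ih with
    | 0, S, _ => exact (CombPos.zero _).congr fun p => by rw [sahiE_zero]
    | 1, S, _ =>
      have hdeg : (fun e => ∑ j : Fin 1, if e ∈ S j then 1 else (0 : ℕ)) = fun e => if e ∈ S 0 then 1 else 0 := by
        funext e; rw [Fin.sum_univ_one]
      rw [hdeg]
      exact (combPos_ex_ind_cyl (S 0)).congr fun p => by rw [sahiE_one_apply]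
    | k + 2, S, ih =>
      set R : Set ι := S 0 with hR
      set T : Fin (k + 1) → Set ι := fun j => S j.succ with hT
      have hfam : (fun j => ind {ω : Set ι | S j ⊆ ω}) = Matrix.vecCons (ind {ω : Set ι | R ⊆ ω}) (fun j => ind {ω : Set ι | T j ⊆ ω}) := by
        funext j; refine Fin.cases rfl (fun i => rfl) j
      have hdeg : (fun e => ∑ j, if e ∈ S j then 1 else (0 : ℕ)) = fun e => (if e ∈ R then 1 else 0) + ∑ j, if e ∈ T j then 1 else 0 := by
        funext e; simp only [hR, hT, Fin.sum_univ_succ]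
      rw [hdeg, hfam]
      refine combPos_cyl_head R T fun A => ?_
      have h := ih A.card (lt_of_le_of_lt (by simpa using Finset.card_le_univ A) (by omega))
        (fun j => T (A.orderEmbOfFin rfl j) \ R)
      have h' : CombPos (fun e => ∑ j ∈ A, if e ∈ T j \ R then 1 else 0)
          (fun p => sahiE (bernoulliWeight p) A.card (fun j => ind {ω : Set ι | T (A.orderEmbOfFin rfl j) \ R ⊆ ω})) :=
        combPos_of_deg_eq h (by
          funext e
          rw [← sum_orderEmbOfFin' A (fun j => if e ∈ T j \ R then (1 : ℕ) else 0)]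
          exact Finset.sum_congr rfl fun j _ => by congr)
      refine h'.congr fun p => ?_
      simp only [secUnion_cylinder]

end SahiCylMinDeg

end Summit.CriticalPhenomena.PercolationContinuityZ3.Theorems
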